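import Mathlib
import Summits.ValiantsHypothesis.ValiantsHypothesis.Theorems.BarrierLeverDefinableEquationsProductDepthWallTwoIndexOrder
import Summits.ValiantsHypothesis.ValiantsHypothesis.Theorems.BarrierLeverDefinableEquationsProductDepthWallTwoWords

/-!
# Route BarrierLever — crux `DefinableEquations` (stmt-8745) / item `SingleSizeEquations`
# (stmt-8749): g10's LST witness `e_*(P_w)` VERBATIM lies in `SmallCircuits ℂ n 2`
# (val-np-p5 g15, second addendum to `…ProductDepthWallTwo*`)

The wall `…ProductDepthWallTwo.lean` uses the word polynomial of a REORDERED word (linear size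
`6n`, no side condition).  Here: under g10's own hypotheses (`d ≤ n`, side condition
`2^{|w_{[t]}|} ≤ n` for `t ≤ d`, blocks embedded among `x_1, …, x_n`) the UNREORDERED placed word
polynomial `e_*(P_w)` already has complexity `≤ n²` for `n ≥ 6` (`complexity_placedWordPoly_le_sq`),
so `e_*(P_w) ∈ SmallCircuits ℂ n b` for every `b ≥ 2` (`placedWordPoly_mem_smallCircuits_two`;
g10: `b = 5`, first addendum: `b = 3`).  Proof: if `⌊k/√2⌋ ≥ 1` every block has `≥ 2` variables, so
`2d ≤ n` and the index-order count `2dn` (`complexity_wordPoly_le_index`) is `≤ n²`; if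
`⌊k/√2⌋ = 0` every block is free (positive blocks carry no bits, negative blocks always lie on
the longer-or-equal side) and `complexity_wordPoly_le_of_mergePrefix` with an empty prefix gives
`≤ 6 · #variables ≤ 6n`.

What this is NOT: nothing on the crux (b = 2 OPEN, Chatterjee–Tengse §1.3 dir. 2) or `VP ≠ VNP`;
no definitions, no named facts, standard axioms.
Refs: Limaye–Srinivasan–Tavenas, J. ACM 72 (2025) Art. 26, Lemma 8, Lemma 22; Forbes–Shpilka–Volk 2018 Cor. 5.
-/

-- `Summit.ValiantsHypothesis.ValiantsHypothesis.…` repeats a component (D-0017 layout); mandated.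
set_option linter.dupNamespace false

noncomputable section

namespace Summit.ValiantsHypothesis.ValiantsHypothesis.Theorems.BarrierLeverDefinableEquations

open MvPolynomial
open Literature.Computability.AlgebraicComplexity
open Literature.Computability.AlgebraicComplexity.LSTWord
open Literature.Barriers.ValiantsHypothesis
open scoped BigOperators

namespace ProductDepthWallTwo

variable {D : ℕ} (k : ℕ) (pos : Fin D → Bool)

/-- The number of block variables is at most `n` when the blocks embed among `x_1, …, x_n`.
[folklore] -/
theorem sum_pow_letterSize_le {n : ℕ} (e : (Σ i : Fin D, BlockVar k pos i) ↪ Fin n) :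
    ∑ t : Fin D, 2 ^ letterSize k pos t ≤ n := by
  classical
  calc ∑ t : Fin D, 2 ^ letterSize k pos t = Fintype.card (Σ t : Fin D, BlockVar k pos t) := by
        rw [Fintype.card_sigma]
        exact Finset.sum_congr rfl fun t _ => (card_blockVar k pos t).symm
    _ ≤ Fintype.card (Fin n) := Fintype.card_le_of_embedding e
    _ = n := Fintype.card_fin n

/-- If `⌊k/√2⌋ = 0` the positive stream is always empty. [cite: LimayeSrinivasanTavenas2025, §2.2] -/
theorem streamLen_true_eq_zero (hk : posLetter k = 0) (t : ℕ) : streamLen k pos true t = 0 := by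
  induction t with
  | zero => rfl
  | succ t ih =>
    unfold streamLen
    rw [ih, zero_add]
    split_ifs with h1 h2
    · rw [letterSize, if_pos h2, hk]
    · rfl
    · rfl

/-- **`L(e_*(P_w)) ≤ n²` for the UNREORDERED word** (`n ≥ 6`, `d ≤ n`, side condition
`2^{|w_{[t]}|} ≤ n`). [cite: LimayeSrinivasanTavenas2025, Lemma 8 and Lemma 22] -/
theorem complexity_placedWordPoly_le_sq {n : ℕ} (h6 : 6 ≤ n)
    (hn : ∀ t ≤ D, 2 ^ overLen k pos t ≤ n) (e : (Σ i : Fin D, BlockVar k pos i) ↪ Fin n) :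
    complexity (rename e (wordPoly k pos ℂ)) ≤ n ^ 2 := by
  classical
  refine (complexity_rename_le_holds' (k := ℂ) e _).trans ?_
  have hvars := sum_pow_letterSize_le k pos e
  by_cases hk : 1 ≤ posLetter k
  · -- every block has at least two variables, so `2d ≤ n`
    have h2D : 2 * D ≤ n := by
      have h2 : ∀ t : Fin D, 2 ≤ 2 ^ letterSize k pos t := fun t => by
        have h1 : 1 ≤ letterSize k pos t := by
          unfold letterSize
          split_ifs
          · exact hk
          · exact hk.trans (posLetter_le k)
        calc 2 = 2 ^ 1 := (pow_one 2).symm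
          _ ≤ 2 ^ letterSize k pos t := Nat.pow_le_pow_right (by norm_num) h1
      calc 2 * D = ∑ _t : Fin D, 2 := by
            rw [Finset.sum_const, Finset.card_univ, Fintype.card_fin, smul_eq_mul, mul_comm]
        _ ≤ ∑ t : Fin D, 2 ^ letterSize k pos t := Finset.sum_le_sum fun t _ => h2 t
        _ ≤ n := hvars
    calc complexity (wordPoly k pos ℂ) ≤ 2 * D * n := complexity_wordPoly_le_index k pos ℂ hn e
      _ ≤ n * n := Nat.mul_le_mul_right _ h2D
      _ = n ^ 2 := (sq n).symm
  · -- no positive bits: every block is free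
    have hk0 : posLetter k = 0 := by omega
    have hfree : ∀ t : Fin D, 0 ≤ (t : ℕ) →
        streamLen k pos (!pos t) t ≤ streamLen k pos (pos t) t ∨ letterSize k pos t = 0 := by
      intro t _
      cases hpt : pos t
      · left
        rw [Bool.not_false, streamLen_true_eq_zero k pos hk0]
        exact Nat.zero_le _
      · right
        rw [letterSize, if_pos hpt, hk0]
    calc complexity (wordPoly k pos ℂ) ≤ 6 * ∑ t : Fin D, 2 ^ letterSize k pos t :=
          complexity_wordPoly_le_of_mergePrefix k ℂ 0 D D (by simp) pos
            (fun t ht => absurd ht (Nat.not_lt_zero _)) (fun t ht => absurd ht (Nat.not_lt_zero _))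
            hfree
      _ ≤ 6 * n := Nat.mul_le_mul_left _ hvars
      _ ≤ n * n := Nat.mul_le_mul_right _ h6
      _ = n ^ 2 := (sq n).symm

/-- **g10's witness verbatim at the open rung**: `e_*(P_w) ∈ SmallCircuits ℂ n b` for every
`b ≥ 2`, `n ≥ 6`, `d ≤ n`, under the side condition `2^{|w_{[t]}|} ≤ n` — with full block rank
`pdRank (killCompl e (e_*(P_w))) = 2^{min(|σ⁺|,|σ⁻|)}` (tree `pdRank_wordPoly`).
[cite: ForbesShpilkaVolk2018, Cor. 5] -/
theorem placedWordPoly_mem_smallCircuits_two {n : ℕ} (h6 : 6 ≤ n) (hdn : D ≤ n)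
    (hn : ∀ t ≤ D, 2 ^ overLen k pos t ≤ n) (e : (Σ i : Fin D, BlockVar k pos i) ↪ Fin n)
    {b : ℕ} (hb : 2 ≤ b) :
    rename e (wordPoly k pos ℂ) ∈ SmallCircuits ℂ n b ∧
      pdRank ℂ (posBlocks pos) (negBlocks pos) (killCompl e.injective (rename e (wordPoly k pos ℂ))) =
        2 ^ min (streamLen k pos true D) (streamLen k pos false D) := by
  refine ⟨⟨(totalDegree_rename_le _ _).trans ((ProductDepthWall.totalDegree_wordPoly_le k pos).trans hdn),
    (complexity_placedWordPoly_le_sq k pos h6 hn e).trans (Nat.pow_le_pow_right (by omega) hb)⟩, ?_⟩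
  rw [killCompl_rename_app]
  exact pdRank_wordPoly k pos ℂ

end ProductDepthWallTwo

end Summit.ValiantsHypothesis.ValiantsHypothesis.Theorems.BarrierLeverDefinableEquations
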